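import Summits.CriticalPhenomena.PercolationContinuityZ3.Theorems.Transplant.SkelFrmBChoiceDefsV
import Summits.CriticalPhenomena.PercolationContinuityZ3.Theorems.Transplant.SkelPhiRootRoomsV
import Summits.CriticalPhenomena.PercolationContinuityZ3.Theorems.Transplant.SkelFrmBParamsSlotsS
import HarnessLib

/-!
# N2 (frames-only node `SamePDropOfSkeletonFrm₁`, OPEN), (R) column, reading rows (V): **THE ROOT WORLD'S PLANAR DIAMETER — the skeletons' `hDm`**
# `NegB.hDm_R`: for every step direction `du`, window radius `R` and seed level, two vertices of the cut root world
# `(U0root du ∩ B_G(t, R)) ∖ Λ(t,k)` of the scheme of record `ΓQV` differ, in the long map `φL`, by a vector of `box 2 (mRS … mx)`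

Composition of hp-8 g43's `Skelφ.ψ_sub_mem_box_of_mem_U0rootV` (SkelPhiRootRoomsV: `U0root du ⊆ Cell 0 ∪ Cell (0 + du)`, fine diameter `≤ 40·rmax`)
with `box_mono` (`40·rmax ≤ 50·rmax`) and stmt's `fine_diam_le_mRS` (SkelFrmBParamsSlotsS: a fine box of `50·rmax` is a `φ′`-box of `mRS … mx`); the
scheme `ΓQV … = cellGeomSG₂bV G (fineOA …) (fcellsV …) t (schedOfT …) (bOf …)` and `fineOA … = fineA … (φL …)` hold by `rfl` (SkelFrmBChoiceDefsV,
SkelFrmBParamsLOA).  This is the `hDm` binder of BOTH (R) skeletons `rootLegAt_frmQ3KV_fst/_snd` (and of their `_of_le` wrappers) at `φe := φL`,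
`m := mRS … (mx …)` — the shape the rim device `hR₁_US` reads.
NON-VACUITY (lead g11 standing order): a theorem for every slot tuple and every `du`; nothing assumed.
builds on p205010 (kernel theorem, internal audit signed; external expert review pending) — nothing in this file uses p205010; NOTHING is claimed
about the open node `SamePDropOfSkeletonFrm₁`.
Lane `prim-bschramm`, seat `prim-bschramm-p3` (gen 18; N2 design owner, (R) column owner); helper file (`--supports stmt-CriticalPhenomena-4575 --as helper`).
[cite: KozmaNitzan2024, §4 p. 28 ((32) at the root), Lemma 12 (p. 24)]
-/

noncomputable section

open scoped Classical

namespace Summit.CriticalPhenomena.PercolationContinuityZ3.Theorems.Transplant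

open MeasureTheory Literature.Probability.Percolation Literature.Probability.LatticeModels SimpleGraph KNCells KNLevels
open Literature.Barriers.CriticalPhenomena (graphBall)

namespace PlanarSkeletonFrm

open SkelConc (Consts)
open Skelφ.StepI (DataN DataNS OutNS)

namespace NegB

open Neg

section Diam

variable (κ : Consts) {V : Type} [DecidableEq V] [Countable V] {G : SimpleGraph V} [G.LocallyFinite] (Φ : PlanarSkeletonFrm G) (t : V) (p : unitInterval)
  (O : OutNS V) (gv fv : Neg.FSlot) (Sv : SSlot) (cv hv : CSlot) (bv : BSlot) (q : unitInterval) (mx : GSlot)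

/-- **THE `hDm` ROW OF THE (R) SKELETONS AT THE SCHEME OF RECORD `ΓQV`** (any direction `du`, window radius `R`, seed set `A`): two vertices of the
cut root world `(U0root du ∩ B_G(t, R)) ∖ A` differ in `φL` by a vector of `box 2 (mRS … (mx …))`. [cite: KozmaNitzan2024, §4 p. 28 ((32) at the root)] -/
theorem hDm_R (hN : EqNumL κ Φ t p O.merged (gOf κ Φ t p O gv) (fOf κ Φ t p O fv)) (du : MDir) (R : ℕ) (A : Finset V) :
    ∀ d ∈ ((((KSchA.mk (ΓQV κ Φ t p O gv fv Sv cv hv bv q) q κ.δ : KSchA V ℕ)).U0root du).filter fun y => y ∈ graphBall G t R) \ A,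
      ∀ d' ∈ ((((KSchA.mk (ΓQV κ Φ t p O gv fv Sv cv hv bv q) q κ.δ : KSchA V ℕ)).U0root du).filter fun y => y ∈ graphBall G t R) \ A,
        (φL κ Φ t p O.D O.DT.toDataN O.ori (gOf κ Φ t p O gv) (fOf κ Φ t p O fv)) d - (φL κ Φ t p O.D O.DT.toDataN O.ori (gOf κ Φ t p O gv) (fOf κ Φ t p O fv)) d' ∈
          box 2 (mRS κ Φ t p O.merged (gOf κ Φ t p O gv) (fOf κ Φ t p O fv) (mx κ Φ t p O.merged (gOf κ Φ t p O gv) (fOf κ Φ t p O fv))) := by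
  intro d hd d' hd'
  have hdU := (Finset.mem_filter.1 (Finset.mem_sdiff.1 hd).1).1
  have hdU' := (Finset.mem_filter.1 (Finset.mem_sdiff.1 hd').1).1
  have h := Skelφ.ψ_sub_mem_box_of_mem_U0rootV
    (fcellsV κ Φ t p O.merged (gOf κ Φ t p O gv) (fOf κ Φ t p O fv) (cOf κ Φ t p O gv fv cv) (hOf κ Φ t p O gv fv hv)) t
    (schedOfT κ Φ t p O.merged (gOf κ Φ t p O gv) (fOf κ Φ t p O fv) (cOf κ Φ t p O gv fv cv) (Sv κ Φ t p O.merged (gOf κ Φ t p O gv) (fOf κ Φ t p O fv) q))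
    (bOf κ Φ t p O gv fv bv) q κ.δ du hdU hdU'
  have hr : (fcellsV κ Φ t p O.merged (gOf κ Φ t p O gv) (fOf κ Φ t p O fv) (cOf κ Φ t p O gv fv cv) (hOf κ Φ t p O gv fv hv)).rmax =
      (fcellsA κ Φ t p O.merged (gOf κ Φ t p O gv) (fOf κ Φ t p O fv)).rmax := rfl
  rw [hr] at h
  have h' : fineA κ Φ t p O.merged (gOf κ Φ t p O gv) (fOf κ Φ t p O fv) (φL κ Φ t p O.D O.DT.toDataN O.ori (gOf κ Φ t p O gv) (fOf κ Φ t p O fv)) d -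
      fineA κ Φ t p O.merged (gOf κ Φ t p O gv) (fOf κ Φ t p O fv) (φL κ Φ t p O.D O.DT.toDataN O.ori (gOf κ Φ t p O gv) (fOf κ Φ t p O fv)) d' ∈
        box 2 (50 * (fcellsA κ Φ t p O.merged (gOf κ Φ t p O gv) (fOf κ Φ t p O fv)).rmax) :=
    box_mono 2 (show 40 * (fcellsA κ Φ t p O.merged (gOf κ Φ t p O gv) (fOf κ Φ t p O fv)).rmax ≤
      50 * (fcellsA κ Φ t p O.merged (gOf κ Φ t p O gv) (fOf κ Φ t p O fv)).rmax by omega) h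
  exact fine_diam_le_mRS κ Φ t p O.merged (gOf κ Φ t p O gv) (fOf κ Φ t p O fv) (mx κ Φ t p O.merged (gOf κ Φ t p O gv) (fOf κ Φ t p O fv)) hN h'

end Diam

end NegB

end PlanarSkeletonFrm

end Summit.CriticalPhenomena.PercolationContinuityZ3.Theorems.Transplant

end
-- build-touch 2026-08-25T06:18:27Z T1-A (lead g18): re-land of p391686, declarations byte-identical
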